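import Literature.Analysis.OperatorTheory.KernelIterateBridge
import Literature.Analysis.OperatorTheory.PositivityImprovingSpectralGap
import Literature.Analysis.OperatorTheory.PowerIterationRatioLimit
import HarnessLib

/-!
# Boundary-independence of transfer-kernel ratios (the analytic core of uniqueness of
# one-dimensional Gibbs states with a strictly positive bounded transfer kernel) — PROVED

Topic `Literature/Analysis/OperatorTheory`; theorems only (no definitions, no named facts).
This file assembles `PositiveKernelTransferOperator.lean` (the transfer operator `A` of a bounded,
symmetric, strictly positive kernel `K` on a finite nonzero measure space `(X, μ)`: compact,
self-adjoint, positivity improving), `PositivityImprovingSpectralGap.lean` (Jentzsch / Kreĭn–Rutman: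
`‖Aⁿ g - ‖A‖ⁿ ⟪φ, g⟫ φ‖ ≤ θⁿ ‖g‖`, `θ < ‖A‖`), `PowerIterationRatioLimit.lean` (uniform convergence of
`⟪Aⁿ k_u, M Aⁿ k_v⟫ / ⟪Aⁿ k_u, M₁ Aⁿ k_v⟫` on `{⟪φ, k_u⟫, ⟪φ, k_v⟫ ≥ δ}`) and `KernelIterateBridge.lean`
(`⟪k_u, A^j [h]⟫ = (κ^[j+1] h)(u)` for the POINTWISE operator `(κ f)(x) = ∫ K(x, y) f(y) dμ(y)`) into
the statement consumed by one-dimensional lattice models, written entirely in terms of honest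
iterated integrals (no `L²` classes in the statement):

* `exists_kernelRatio_tendsto_uniformly` (**main**) — for bounded jointly measurable "insertion
  kernels" `m, m₁` (`m₁ > 0`) there are an integrable `φ₀ ≥ 0`, `φ₀ ≠ 0` (a version of the
  Perron–Frobenius eigenfunction) and a number `L` such that the ratios
  `κⁿ[x ↦ ∫ m(x,y) (κⁿ K(v,·))(y) dμ(y)](u) / κⁿ[x ↦ ∫ m₁(x,y) (κⁿ K(v,·))(y) dμ(y)](u)`
  converge to `L` as `n → ∞`, UNIFORMLY in the boundary points `(u, v)` on every set
  `{∫ φ₀ K(u,·) dμ ≥ δ, ∫ φ₀ K(v,·) dμ ≥ δ}`, `δ > 0`.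

In a nearest-neighbour chain with one-site a priori measure `μ` and bond Boltzmann factor `K`, the
numerator (resp. denominator) is the un-normalised finite-volume Gibbs integral of a window
observable encoded by `m` (resp. of `1`, encoded by `m₁`) with `n` sites between the window and
each of the two boundary spins `u, v`; the theorem says that the finite-volume Gibbs expectation
`γ_Λ(observable | u, v)` becomes independent of the boundary condition, uniformly on the sets where
the overlap `∫ φ₀ K(u, ·) dμ` is bounded below — by `KernelOverlapContinuity.lean` these contain every
compact set of boundary spins (Cassandro–Olivieri–Pellegrinotti–Presutti 1978 §2 for unbounded spins;
Georgii 2011, Thm 10.25, §11.1; Reed–Simon IV, Thms XIII.43–44 for the spectral input). [folklore]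
-/

noncomputable section

open MeasureTheory Set Filter Function
open scoped RealInnerProductSpace ENNReal

namespace Literature.Analysis.OperatorTheory

variable {X : Type*} [MeasurableSpace X] {μ : Measure X} [IsFiniteMeasure μ]
  {K : X → X → ℝ} {C : ℝ}

/-- For a bounded jointly measurable kernel `m` and a bounded strongly measurable `g`, the function
`x ↦ ∫ m(x, y) g(y) dμ(y)` is bounded (by `Cm B μ(X)`) and strongly measurable. [folklore] -/
theorem exists_bound_and_stronglyMeasurable_integral_kernel_mul {m : X → X → ℝ} {Cm : ℝ}
    (hm : StronglyMeasurable (uncurry m)) (hmb : ∀ x y, ‖m x y‖ ≤ Cm) {g : X → ℝ}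
    (hg : StronglyMeasurable g) {B : ℝ} (hgb : ∀ x, ‖g x‖ ≤ B) :
    (∀ x, ‖∫ y, m x y * g y ∂μ‖ ≤ Cm * (B * μ.real univ)) ∧
      StronglyMeasurable fun x => ∫ y, m x y * g y ∂μ := by
  refine ⟨fun x => ?_, (hm.mul (hg.comp_measurable measurable_snd)).integral_prod_right'⟩
  calc ‖∫ y, m x y * g y ∂μ‖ ≤ ∫ y, ‖m x y * g y‖ ∂μ := norm_integral_le_integral_norm _
    _ ≤ ∫ _y, Cm * B ∂μ := by
        refine integral_mono_of_nonneg (Eventually.of_forall fun y => norm_nonneg _)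
          (integrable_const _) (Eventually.of_forall fun y => ?_)
        dsimp only
        rw [norm_mul]
        exact mul_le_mul (hmb x y) (hgb y) (norm_nonneg _) ((norm_nonneg _).trans (hmb x y))
    _ = Cm * (B * μ.real univ) := by rw [integral_const, smul_eq_mul]; ring

variable {A : Lp ℝ 2 μ →L[ℝ] Lp ℝ 2 μ}

/-- **The bridge from iterated integrals to transfer-operator matrix elements.** For the `L²`
realisation `A` of the pointwise operator `κ f = ∫ K(·, y) f(y) dμ(y)` of a bounded symmetric kernel
and the `L²` realisation `Mm` of a bounded insertion kernel `m`,
`κ^[n+1] (x ↦ ∫ m(x,y) (κ^[n+1] K(v,·))(y) dμ(y)) (u) = ⟪Aⁿ k_u, Mm (A (Aⁿ k_v))⟫`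
(`k_u = K(u, ·)`), for EVERY pair of boundary points `u, v`. [folklore] -/
theorem iterate_integral_kernel_eq_inner_pow (hK : StronglyMeasurable (uncurry K))
    (hC : ∀ x y, ‖K x y‖ ≤ C) (hsymm : ∀ x y, K x y = K y x) (hsa : IsSelfAdjoint A)
    (hA : ∀ ψ : Lp ℝ 2 μ, (A ψ : X → ℝ) =ᵐ[μ] fun x => ∫ y, K x y * ψ y ∂μ)
    {m : X → X → ℝ} {Cm : ℝ} (hm : StronglyMeasurable (uncurry m)) (hmb : ∀ x y, ‖m x y‖ ≤ Cm)
    {Mm : Lp ℝ 2 μ →L[ℝ] Lp ℝ 2 μ}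
    (hMm : ∀ ψ : Lp ℝ 2 μ, (Mm ψ : X → ℝ) =ᵐ[μ] fun x => ∫ y, m x y * ψ y ∂μ) (n : ℕ) (u v : X) :
    (fun f : X → ℝ => fun x => ∫ y, K x y * f y ∂μ)^[n + 1]
        (fun x => ∫ y, m x y *
          (fun f : X → ℝ => fun x => ∫ y, K x y * f y ∂μ)^[n + 1] (K v) y ∂μ) u =
      ⟪(A ^ n) ((memLp_kernel_section (μ := μ) hK hC u).toLp (K u)),
        Mm (A ((A ^ n) ((memLp_kernel_section (μ := μ) hK hC v).toLp (K v))))⟫ := by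
  set κ : (X → ℝ) → X → ℝ := fun f x => ∫ y, K x y * f y ∂μ with hκ
  have hKv : Measurable (K v) := hK.measurable.of_uncurry_left
  -- the iterate `G = κ^[n+1] K(v, ·)`: bounded, measurable, and `[G] = A^{n+1} [k_v]`
  obtain ⟨⟨BG, hBG⟩, hGsm⟩ :=
    exists_bound_and_measurable_kernelIterate (μ := μ) hK hC hKv ⟨C, hC v⟩ (n + 1)
  set G : X → ℝ := κ^[n + 1] (K v) with hGdef
  have hGm : Measurable G := hGsm.measurable
  have hGLp : (memLp_two_of_bound (μ := μ) hGm hBG).toLp G =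
      (A ^ (n + 1)) ((memLp_kernel_section (μ := μ) hK hC v).toLp (K v)) := by
    refine Lp.ext ?_
    have h1 := pow_kernelOp_toLp_ae_eq_iterate (μ := μ) hA hKv (fun y => hC v y) (n + 1)
    filter_upwards [(memLp_two_of_bound (μ := μ) hGm hBG).coeFn_toLp, h1] with x hx hx'
    rw [hx, hx']
  -- `F = ∫ m(·, y) G(y) dμ`: bounded, measurable, and `[F] = Mm [G]`
  obtain ⟨hFb, hFsm⟩ :=
    exists_bound_and_stronglyMeasurable_integral_kernel_mul (μ := μ) hm hmb hGsm hBG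
  set F : X → ℝ := fun x => ∫ y, m x y * G y ∂μ with hFdef
  have hFm : Measurable F := hFsm.measurable
  have hFLp : (memLp_two_of_bound (μ := μ) hFm hFb).toLp F =
      Mm ((memLp_two_of_bound (μ := μ) hGm hBG).toLp G) := by
    refine Lp.ext ?_
    filter_upwards [(memLp_two_of_bound (μ := μ) hFm hFb).coeFn_toLp,
      hMm ((memLp_two_of_bound (μ := μ) hGm hBG).toLp G)] with x hx hx'
    rw [hx, hx', hFdef]
    exact integral_congr_ae (by
      filter_upwards [(memLp_two_of_bound (μ := μ) hGm hBG).coeFn_toLp] with y hy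
      rw [hy])
  -- assemble
  have hstep : κ^[n + 1] F u = ⟪(memLp_kernel_section (μ := μ) hK hC u).toLp (K u),
      (A ^ n) ((memLp_two_of_bound (μ := μ) hFm hFb).toLp F)⟫ :=
    (inner_kernel_section_pow_kernelOp hK hC hsymm hA hFm hFb n u).symm
  change κ^[n + 1] F u = _
  rw [hstep, hFLp, hGLp, ← (hsa.pow n).isSymmetric.apply_clm, pow_succ', mul_apply_eq_comp]

/-- **Boundary-independence of transfer-kernel ratios, uniformly on sets of large overlap.** Let
`K` be a bounded, jointly measurable, symmetric, strictly positive kernel on a finite nonzero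
measure space `(X, μ)`, `κ f = ∫ K(·, y) f(y) dμ(y)` its pointwise transfer operator, and `m`, `m₁`
bounded jointly measurable insertion kernels with `m₁ > 0`. Then there are an integrable
`φ₀ ≥ 0`, `φ₀ ≠ 0` (a.e.; a version of the Perron–Frobenius–Jentzsch eigenfunction of the transfer
operator) and `L ∈ ℝ` such that for all `δ, ε > 0` there is `N₀` with
`|κ^[N](x ↦ ∫ m(x,y) (κ^[N] K(v,·))(y) dμ)(u) / κ^[N](x ↦ ∫ m₁(x,y) (κ^[N] K(v,·))(y) dμ)(u) - L| < ε`
for all `N ≥ N₀` and all boundary points `u, v` with `∫ φ₀ K(u,·) dμ, ∫ φ₀ K(v,·) dμ ≥ δ`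
(Jentzsch's spectral gap + power iteration; the mechanism of uniqueness of the shift-invariant
Gibbs state of one-dimensional models with strictly positive Hilbert–Schmidt transfer kernels,
Cassandro–Olivieri–Pellegrinotti–Presutti 1978, Georgii 2011 Thm 10.25 / §11.1). [folklore] -/
theorem exists_kernelRatio_tendsto_uniformly (hK : StronglyMeasurable (uncurry K))
    (hC : ∀ x y, ‖K x y‖ ≤ C) (hsymm : ∀ x y, K x y = K y x) (hpos : ∀ x y, 0 < K x y)
    (hμ : μ ≠ 0) {m m₁ : X → X → ℝ} {Cm Cm₁ : ℝ}
    (hm : StronglyMeasurable (uncurry m)) (hmb : ∀ x y, ‖m x y‖ ≤ Cm)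
    (hm₁ : StronglyMeasurable (uncurry m₁)) (hm₁b : ∀ x y, ‖m₁ x y‖ ≤ Cm₁)
    (hm₁pos : ∀ x y, 0 < m₁ x y) :
    ∃ (φ₀ : X → ℝ) (L : ℝ), Integrable φ₀ μ ∧ (0 ≤ᵐ[μ] φ₀) ∧ (¬ φ₀ =ᵐ[μ] 0) ∧
      ∀ δ : ℝ, 0 < δ → ∀ ε : ℝ, 0 < ε → ∃ N₀ : ℕ, ∀ N : ℕ, N₀ ≤ N → ∀ u v : X,
        δ ≤ ∫ y, φ₀ y * K u y ∂μ → δ ≤ ∫ y, φ₀ y * K v y ∂μ →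
        |(fun f : X → ℝ => fun x => ∫ y, K x y * f y ∂μ)^[N]
            (fun x => ∫ y, m x y *
              (fun f : X → ℝ => fun x => ∫ y, K x y * f y ∂μ)^[N] (K v) y ∂μ) u /
          (fun f : X → ℝ => fun x => ∫ y, K x y * f y ∂μ)^[N]
            (fun x => ∫ y, m₁ x y *
              (fun f : X → ℝ => fun x => ∫ y, K x y * f y ∂μ)^[N] (K v) y ∂μ) u - L| < ε := by
  -- the transfer operator, its gap, and the insertion operators
  obtain ⟨A, hA, hsa, hc, himp, h0⟩ := exists_transferOperator (μ := μ) hK hC hsymm hpos hμ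
  obtain ⟨φ, hφ1, hφpos, hAφ, θ, hθ0, hθ, hpow⟩ := himp.exists_norm_pow_sub_le hsa hc h0
  obtain ⟨Mm, hMm⟩ := exists_kernelOp (μ := μ) hm hmb
  obtain ⟨Mm₁, hMm₁⟩ := exists_kernelOp (μ := μ) hm₁ hm₁b
  have hlam : 0 < ‖A‖ := norm_pos_iff.2 h0
  have hC0 : 0 ≤ C := by
    have : μ univ ≠ 0 := fun h => hμ (Measure.measure_univ_eq_zero.1 h)
    obtain ⟨x, -⟩ := nonempty_of_measure_ne_zero this
    exact (norm_nonneg _).trans (hC x x)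
  set M : Lp ℝ 2 μ →L[ℝ] Lp ℝ 2 μ := Mm.comp A with hMdef
  set M₁ : Lp ℝ 2 μ →L[ℝ] Lp ℝ 2 μ := Mm₁.comp A with hM₁def
  -- `⟪φ, M₁ φ⟫ > 0`
  have hφP : IsPositiveFun φ := hφpos.isPositiveFun hμ
  have himp₁ : IsPositivityImproving Mm₁ := isPositivityImproving_kernelOp hm₁ hm₁b hm₁pos hMm₁
  have hM₁pos : 0 < ⟪φ, M₁ φ⟫ := by
    have h1 : M₁ φ = ‖A‖ • Mm₁ φ := by
      rw [hM₁def, ContinuousLinearMap.comp_apply, hAφ, map_smul]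
    rw [h1, real_inner_smul_right]
    exact mul_pos hlam (inner_pos hφP (himp₁ φ hφP))
  -- kernel sections
  set ks : X → Lp ℝ 2 μ := fun u => (memLp_kernel_section (μ := μ) hK hC u).toLp (K u) with hks
  have hksb : ∀ u, ‖ks u‖ ≤ (measureUnivNNReal μ : ℝ) ^ (2 : ℝ≥0∞).toReal⁻¹ * C := fun u =>
    norm_kernel_section_le hK hC hC0 u
  -- the eigenfunction as an honest function
  refine ⟨(φ : X → ℝ), ⟪φ, M φ⟫ / ⟪φ, M₁ φ⟫, (Lp.memLp φ).integrable one_le_two,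
    hφpos.mono fun x hx => hx.le, fun h0φ => ?_, fun δ hδ ε hε => ?_⟩
  · have : ∀ᵐ x ∂μ, False := by
      filter_upwards [hφpos, h0φ] with x hx hx0
      rw [hx0, Pi.zero_apply] at hx
      exact lt_irrefl 0 hx
    exact hμ (MeasureTheory.ae_eq_bot.1 (Filter.eventually_false_iff_eq_bot.1 this))
  · obtain ⟨N₀, hN₀⟩ := exists_forall_abs_ratio_sub_lt (A := A) (M := M) (M₁ := M₁) hlam hθ0 hθ
      hpow (k := ks) hksb hM₁pos hδ hε
    refine ⟨N₀ + 1, fun N hN u v hu hv => ?_⟩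
    obtain ⟨n, rfl⟩ : ∃ n, N = n + 1 := ⟨N - 1, by omega⟩
    have hn : N₀ ≤ n := by omega
    have hcu : δ ≤ ⟪φ, ks u⟫ := by rwa [hks, inner_kernel_section hK hC φ u]
    have hcv : δ ≤ ⟪φ, ks v⟫ := by rwa [hks, inner_kernel_section hK hC φ v]
    have h := hN₀ n hn u v hcu hcv
    rw [iterate_integral_kernel_eq_inner_pow hK hC hsymm hsa hA hm hmb hMm n u v,
      iterate_integral_kernel_eq_inner_pow hK hC hsymm hsa hA hm₁ hm₁b hMm₁ n u v]
    simpa only [hMdef, hM₁def, ContinuousLinearMap.comp_apply] using h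

end Literature.Analysis.OperatorTheory

end
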